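import Summits.ValiantsHypothesis.ValiantsHypothesis.Theorems.LacunarySymmetroidMatrixDescartesDoorA26WallBubblingTwoScaleMonotone
import Summits.ValiantsHypothesis.ValiantsHypothesis.Theorems.LacunarySymmetroidMatrixDescartesDoorA26WallBubblingDoublyConfluentFrame

/-!
# Wall bubbling for `DoorA26` — TWO WEYL PAIRS, rung 1: TROPICAL MONOTONICITY OF DOUBLY-CONFLUENT LIMITS ACROSS TWO SCALES

HONEST FRAMING.  Chain lemma for obligation (W) `stub_weylFaces` of `Cruxes/DoorA26/Lines/wall_bubbling.lean` (stmt-ValiantsHypothesis-19979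
`DoorA26`; OPEN, typed, never asserted), W1 seat val-sym-door-p2 g13 (#46) — step 2 (first rung) of the two-dslope port plan
`HOME/val-sym-door-p2/g13/TWO-DSLOPE-CHAIN-PORT.md` towards the chains `hC1`/`hC2`/`hVG2` of W1 #43/#44.  This is W2's rung 1 `…TwoScaleMonotone`
(door-p1 g14) with the TWO-DSLOPE FRAME of W1 #25 (positions `0 ↦ U₀+U₅`, `1 ↦ U₁+U₄`, `4 ↦ (δ₄−δ₁)U₄`, `5 ↦ (δ₅−δ₀)U₅`): the frames at two
clusters at log-distance `L → +∞` are linked by TWO commuting transvections (`frame_shift₂`):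
`V'_l = e^{δ_l L}·(V_l + [l = 0]·Λ₀₅·V₅ + [l = 1]·Λ₁₄·V₄)`, `Λ₀₅ = dslope (y ↦ e^{yL}) 0 (δ₅−δ₀)`, `Λ₁₄ = dslope (y ↦ e^{yL}) 0 (δ₄−δ₁)`, each mixing
polar Gram entries only WITHIN a limit-value class; transfer bound `(1 + |Λ₀₅| + |Λ₁₄|)²` (`polar_shift_le₂`, `polar_frameShift_le₂`); then

* **`twoPair_twoScale_monotone`** — W2's `twoScale_monotone` verbatim for the two-dslope frames: if the Gram-normalised frames converge at both
  clusters with dominated entries, an entry alive in the first limit has limit value `≤` that of any entry alive in the second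
  (`Γ p q ≠ 0 → Γ' p' q' ≠ 0 → δ0 p + δ0 q ≤ δ0 p' + δ0 q'`) — the `hmono` input of `chain_ceiling` at two-pair points.
  Mechanism as W2's, with `|w| ≤ d/32` for both confluent gaps so that `1 + |Λ₀₅| + |Λ₁₄| ≤ 1 + L e^{dL/16}` late, and W2's `transvection_decay`.

No new definitions; W2's scalar lemmas (`abs_dslope_exp_le`, `shift_neg_shift`, `scale_combine`, `transvection_decay`, `polar_add_smul_left`) reused.
Nothing here bears on `DoorA26`, `MatrixDescartes` (stmt-ValiantsHypothesis-18050) or `VP ≠ VNP`; the two-pair chains stay OPEN (rungs 2–5 and the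
mixed-class rung are not ported).  `--supports stmt-ValiantsHypothesis-19979 --as helper`.  [this work = W2's rung 1, re-framed].
-/

-- `Summit.ValiantsHypothesis.ValiantsHypothesis.…` repeats a component by the D-0017 layout
-- (single-conjunct summit), which the `dupNamespace` linter flags; the name is mandated.
set_option linter.dupNamespace false

namespace Summit.ValiantsHypothesis.ValiantsHypothesis.Theorems.LacunarySymmetroidMatrixDescartes.WallBubbling

open Finset Filter Topology
open Bubbling (polar polar_apply polar_comm polar_smul_left_right)
open scoped BigOperators

/-! ## 1. The two transvections -/

/-- **THE TWO-SCALE TRANSFER OF THE TWO-DSLOPE FRAME.**  With `U'_l = e^{δ_l L}U_l`: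
`V'_l = e^{δ_l L}·(V_l + [l = 0]·Λ₀₅·V₅ + [l = 1]·Λ₁₄·V₄)`. [this work] -/
theorem frame_shift₂ (δ : Fin 6 → ℝ) (U : Fin 6 → Matrix (Fin 2) (Fin 2) ℝ) (L : ℝ) (l : Fin 6) :
    (if l = 0 then Real.exp (δ 0 * L) • U 0 + Real.exp (δ 5 * L) • U 5
      else if l = 1 then Real.exp (δ 1 * L) • U 1 + Real.exp (δ 4 * L) • U 4
      else if l = 4 then (δ 4 - δ 1) • (Real.exp (δ 4 * L) • U 4)
      else if l = 5 then (δ 5 - δ 0) • (Real.exp (δ 5 * L) • U 5) else Real.exp (δ l * L) • U l)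
      = Real.exp (δ l * L) • ((if l = 0 then U 0 + U 5 else if l = 1 then U 1 + U 4 else if l = 4 then (δ 4 - δ 1) • U 4
            else if l = 5 then (δ 5 - δ 0) • U 5 else U l)
          + (if l = 0 then dslope (fun y : ℝ => Real.exp (y * L)) 0 (δ 5 - δ 0) else 0) • ((δ 5 - δ 0) • U 5)
          + (if l = 1 then dslope (fun y : ℝ => Real.exp (y * L)) 0 (δ 4 - δ 1) else 0) • ((δ 4 - δ 1) • U 4)) := by
  by_cases h0 : l = 0
  · subst h0
    have h01 : ((0 : Fin 6) = 1) = False := by simp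
    have h04 : ((0 : Fin 6) = 4) = False := by simp
    have h05 : ((0 : Fin 6) = 5) = False := by simp
    simp only [if_true, h01, h04, h05, if_false, zero_smul, add_zero]
    have key : Real.exp (δ 5 * L) = Real.exp (δ 0 * L) * (1 + dslope (fun y : ℝ => Real.exp (y * L)) 0 (δ 5 - δ 0) * (δ 5 - δ 0)) := by
      have h := sub_mul_dslope_exp 0 (δ 5 - δ 0) L
      rw [zero_mul, Real.exp_zero, sub_zero] at h
      rw [mul_comm (dslope _ _ _), h, add_sub_cancel, ← Real.exp_add]
      congr 1; ring
    rw [key]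
    simp only [smul_add, smul_smul]
    module
  by_cases h1 : l = 1
  · subst h1
    have h14 : ((1 : Fin 6) = 4) = False := by simp
    have h15 : ((1 : Fin 6) = 5) = False := by simp
    simp only [h0, if_true, h14, h15, if_false, zero_smul, add_zero]
    have key : Real.exp (δ 4 * L) = Real.exp (δ 1 * L) * (1 + dslope (fun y : ℝ => Real.exp (y * L)) 0 (δ 4 - δ 1) * (δ 4 - δ 1)) := by
      have h := sub_mul_dslope_exp 0 (δ 4 - δ 1) L
      rw [zero_mul, Real.exp_zero, sub_zero] at h
      rw [mul_comm (dslope _ _ _), h, add_sub_cancel, ← Real.exp_add]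
      congr 1; ring
    rw [key]
    simp only [smul_add, smul_smul]
    module
  by_cases h4 : l = 4
  · subst h4
    simp only [h0, h1, if_false, if_true, zero_smul, add_zero]
    rw [smul_comm]
  by_cases h5 : l = 5
  · subst h5
    simp only [h0, h1, h4, if_false, if_true, zero_smul, add_zero]
    rw [smul_comm]
  · simp only [h0, h1, h4, h5, if_false, zero_smul, add_zero]

/-! ## 2. Transfer bounds for the polar Gram entries -/

/-- One-sided expansion bound: `|polar (X + c•Z + d•Y) T| ≤ (1 + |c| + |d|)·M` if `|polar X T|, |polar Z T|, |polar Y T| ≤ M`. [folklore] -/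
theorem abs_polar_add_smul_smul_le (X Y Z T : Matrix (Fin 2) (Fin 2) ℝ) (c d M : ℝ)
    (hX : |polar X T| ≤ M) (hZ : |polar Z T| ≤ M) (hY : |polar Y T| ≤ M) :
    |polar (X + c • Z + d • Y) T| ≤ (1 + |c| + |d|) * M := by
  rw [polar_add_smul_left, polar_add_smul_left]
  have hM : 0 ≤ M := le_trans (abs_nonneg _) hX
  calc |polar X T + c * polar Z T + d * polar Y T|
      ≤ |polar X T| + |c * polar Z T| + |d * polar Y T| := by
        have t1 := abs_add_le (polar X T + c * polar Z T) (d * polar Y T)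
        have t2 := abs_add_le (polar X T) (c * polar Z T)
        linarith
    _ ≤ M + |c| * M + |d| * M := by
        rw [abs_mul, abs_mul]
        exact add_le_add (add_le_add hX (mul_le_mul_of_nonneg_left hZ (abs_nonneg _))) (mul_le_mul_of_nonneg_left hY (abs_nonneg _))
    _ = (1 + |c| + |d|) * M := by ring

/-- Forward bound with two transvections: `|G'_{pq}| ≤ e^{(δ_p+δ_q)L}(1 + |Λ| + |Λ'|)²·μ` when all `|G_{ab}| ≤ μ`. [this work] -/
theorem polar_shift_le₂ (V : Fin 6 → Matrix (Fin 2) (Fin 2) ℝ) (δ : Fin 6 → ℝ) (L Λ Λ' μ : ℝ) (hμ : ∀ a b, |polar (V a) (V b)| ≤ μ)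
    (p q : Fin 6) :
    |polar (Real.exp (δ p * L) • (V p + (if p = 0 then Λ else 0) • V 5 + (if p = 1 then Λ' else 0) • V 4))
        (Real.exp (δ q * L) • (V q + (if q = 0 then Λ else 0) • V 5 + (if q = 1 then Λ' else 0) • V 4))|
      ≤ Real.exp ((δ p + δ q) * L) * (1 + |Λ| + |Λ'|) ^ 2 * μ := by
  have hμ0 : 0 ≤ μ := le_trans (abs_nonneg _) (hμ 0 0)
  have hc : ∀ r : Fin 6, |(if r = 0 then Λ else 0)| ≤ |Λ| := by
    intro r; split_ifs
    · exact le_refl _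
    · rw [abs_zero]; exact abs_nonneg _
  have hd : ∀ r : Fin 6, |(if r = 1 then Λ' else 0)| ≤ |Λ'| := by
    intro r; split_ifs
    · exact le_refl _
    · rw [abs_zero]; exact abs_nonneg _
  set c := (if p = 0 then Λ else 0) with hcdef
  set d := (if p = 1 then Λ' else 0) with hddef
  set c' := (if q = 0 then Λ else 0) with hc'def
  set d' := (if q = 1 then Λ' else 0) with hd'def
  set B := V q + c' • V 5 + d' • V 4 with hB
  -- entries against `B`
  have hB1 : ∀ x, |polar (V x) B| ≤ (1 + |c'| + |d'|) * μ := by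
    intro x
    rw [hB, polar_comm]
    exact abs_polar_add_smul_smul_le (V q) (V 4) (V 5) (V x) c' d' μ (hμ q x) (hμ 5 x) (hμ 4 x)
  have hA : |polar (V p + c • V 5 + d • V 4) B| ≤ (1 + |c| + |d|) * ((1 + |c'| + |d'|) * μ) :=
    abs_polar_add_smul_smul_le (V p) (V 4) (V 5) B c d _ (hB1 p) (hB1 5) (hB1 4)
  have hAB : (1 + |c| + |d|) * ((1 + |c'| + |d'|) * μ) ≤ (1 + |Λ| + |Λ'|) ^ 2 * μ := by
    have h1 : 1 + |c| + |d| ≤ 1 + |Λ| + |Λ'| := by linarith [hc p, hd p]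
    have h2 : 1 + |c'| + |d'| ≤ 1 + |Λ| + |Λ'| := by linarith [hc q, hd q]
    have h1' : 0 ≤ 1 + |c| + |d| := by positivity
    have h2' : 0 ≤ 1 + |c'| + |d'| := by positivity
    calc (1 + |c| + |d|) * ((1 + |c'| + |d'|) * μ) = ((1 + |c| + |d|) * (1 + |c'| + |d'|)) * μ := by ring
      _ ≤ ((1 + |Λ| + |Λ'|) * (1 + |Λ| + |Λ'|)) * μ :=
          mul_le_mul_of_nonneg_right (mul_le_mul h1 h2 h2' (by positivity)) hμ0
      _ = (1 + |Λ| + |Λ'|) ^ 2 * μ := by ring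
  rw [polar_smul_left_right, abs_mul, abs_mul, abs_of_pos (Real.exp_pos _), abs_of_pos (Real.exp_pos _), add_mul, Real.exp_add]
  calc Real.exp (δ p * L) * Real.exp (δ q * L) * |polar (V p + c • V 5 + d • V 4) B|
      ≤ Real.exp (δ p * L) * Real.exp (δ q * L) * ((1 + |Λ| + |Λ'|) ^ 2 * μ) :=
        mul_le_mul_of_nonneg_left (le_trans hA hAB) (mul_pos (Real.exp_pos _) (Real.exp_pos _)).le
    _ = _ := by ring

/-- The forward bound AT THE FRAME LEVEL (two-dslope frames of the shifted letters `e^{δ_l L}U_l` against those of `U`). [this work] -/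
theorem polar_frameShift_le₂ (δ : Fin 6 → ℝ) (U : Fin 6 → Matrix (Fin 2) (Fin 2) ℝ) (L μ : ℝ)
    (hμ : ∀ a b, |polar (if a = 0 then U 0 + U 5 else if a = 1 then U 1 + U 4 else if a = 4 then (δ 4 - δ 1) • U 4
        else if a = 5 then (δ 5 - δ 0) • U 5 else U a)
      (if b = 0 then U 0 + U 5 else if b = 1 then U 1 + U 4 else if b = 4 then (δ 4 - δ 1) • U 4
        else if b = 5 then (δ 5 - δ 0) • U 5 else U b)| ≤ μ) (p q : Fin 6) :
    |polar (if p = 0 then Real.exp (δ 0 * L) • U 0 + Real.exp (δ 5 * L) • U 5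
        else if p = 1 then Real.exp (δ 1 * L) • U 1 + Real.exp (δ 4 * L) • U 4
        else if p = 4 then (δ 4 - δ 1) • (Real.exp (δ 4 * L) • U 4)
        else if p = 5 then (δ 5 - δ 0) • (Real.exp (δ 5 * L) • U 5) else Real.exp (δ p * L) • U p)
      (if q = 0 then Real.exp (δ 0 * L) • U 0 + Real.exp (δ 5 * L) • U 5
        else if q = 1 then Real.exp (δ 1 * L) • U 1 + Real.exp (δ 4 * L) • U 4
        else if q = 4 then (δ 4 - δ 1) • (Real.exp (δ 4 * L) • U 4)
        else if q = 5 then (δ 5 - δ 0) • (Real.exp (δ 5 * L) • U 5) else Real.exp (δ q * L) • U q)|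
      ≤ Real.exp ((δ p + δ q) * L) * (1 + |dslope (fun y : ℝ => Real.exp (y * L)) 0 (δ 5 - δ 0)|
          + |dslope (fun y : ℝ => Real.exp (y * L)) 0 (δ 4 - δ 1)|) ^ 2 * μ := by
  have h50 : ((5 : Fin 6) = 0) = False := by simp
  have h51 : ((5 : Fin 6) = 1) = False := by simp
  have h54 : ((5 : Fin 6) = 4) = False := by simp
  have h40 : ((4 : Fin 6) = 0) = False := by simp
  have h41 : ((4 : Fin 6) = 1) = False := by simp
  have key := polar_shift_le₂ (fun a => if a = 0 then U 0 + U 5 else if a = 1 then U 1 + U 4 else if a = 4 then (δ 4 - δ 1) • U 4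
      else if a = 5 then (δ 5 - δ 0) • U 5 else U a) δ L
    (dslope (fun y : ℝ => Real.exp (y * L)) 0 (δ 5 - δ 0)) (dslope (fun y : ℝ => Real.exp (y * L)) 0 (δ 4 - δ 1)) μ hμ p q
  simp only [h50, h51, h54, h40, h41, if_false, if_true] at key
  rw [frame_shift₂ δ U L p, frame_shift₂ δ U L q]
  exact key

/-! ## 3. Tropical monotonicity across two scales, two Weyl pairs -/

/-- **TROPICAL MONOTONICITY OF DOUBLY-CONFLUENT LIMITS ACROSS TWO SCALES** (the `hmono` input of `chain_ceiling` at a two-Weyl-pair point).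
Letters `U^ν` (recentred at the first cluster), exponents `δ^ν → δ0` with `δ0 5 = δ0 0`, `δ0 4 = δ0 1`, shifts `L_ν → +∞`; the two-dslope frames of
`U^ν` and of the shifted letters `e^{δ_l L}U^ν_l` (both inline).  If the Gram-normalised frames converge at both scales with dominated entries, an
entry alive in the first limit has limit value at most that of any entry alive in the second. [this work = W2's rung 1, two transvections] -/
theorem twoPair_twoScale_monotone (δs : ℕ → Fin 6 → ℝ) (δ0 : Fin 6 → ℝ)
    (hδ : ∀ l, Tendsto (fun ν => δs ν l) atTop (𝓝 (δ0 l))) (h50 : δ0 5 = δ0 0) (h41 : δ0 4 = δ0 1)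
    (U : ℕ → Fin 6 → Matrix (Fin 2) (Fin 2) ℝ) (L : ℕ → ℝ) (hL : Tendsto L atTop atTop)
    (μ μ' : ℕ → ℝ) (hμ : ∀ ν, 0 < μ ν) (hμ' : ∀ ν, 0 < μ' ν)
    (hdom : ∀ ν a b, |polar (if a = 0 then U ν 0 + U ν 5 else if a = 1 then U ν 1 + U ν 4
        else if a = 4 then (δs ν 4 - δs ν 1) • U ν 4 else if a = 5 then (δs ν 5 - δs ν 0) • U ν 5 else U ν a)
      (if b = 0 then U ν 0 + U ν 5 else if b = 1 then U ν 1 + U ν 4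
        else if b = 4 then (δs ν 4 - δs ν 1) • U ν 4 else if b = 5 then (δs ν 5 - δs ν 0) • U ν 5 else U ν b)| ≤ μ ν)
    (hdom' : ∀ ν a b, |polar
      (if a = 0 then Real.exp (δs ν 0 * L ν) • U ν 0 + Real.exp (δs ν 5 * L ν) • U ν 5
        else if a = 1 then Real.exp (δs ν 1 * L ν) • U ν 1 + Real.exp (δs ν 4 * L ν) • U ν 4
        else if a = 4 then (δs ν 4 - δs ν 1) • (Real.exp (δs ν 4 * L ν) • U ν 4)
        else if a = 5 then (δs ν 5 - δs ν 0) • (Real.exp (δs ν 5 * L ν) • U ν 5) else Real.exp (δs ν a * L ν) • U ν a)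
      (if b = 0 then Real.exp (δs ν 0 * L ν) • U ν 0 + Real.exp (δs ν 5 * L ν) • U ν 5
        else if b = 1 then Real.exp (δs ν 1 * L ν) • U ν 1 + Real.exp (δs ν 4 * L ν) • U ν 4
        else if b = 4 then (δs ν 4 - δs ν 1) • (Real.exp (δs ν 4 * L ν) • U ν 4)
        else if b = 5 then (δs ν 5 - δs ν 0) • (Real.exp (δs ν 5 * L ν) • U ν 5) else Real.exp (δs ν b * L ν) • U ν b)| ≤ μ' ν)
    (Γ Γ' : Fin 6 → Fin 6 → ℝ)
    (hΓ : ∀ a b, Tendsto (fun ν => polar (if a = 0 then U ν 0 + U ν 5 else if a = 1 then U ν 1 + U ν 4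
        else if a = 4 then (δs ν 4 - δs ν 1) • U ν 4 else if a = 5 then (δs ν 5 - δs ν 0) • U ν 5 else U ν a)
      (if b = 0 then U ν 0 + U ν 5 else if b = 1 then U ν 1 + U ν 4
        else if b = 4 then (δs ν 4 - δs ν 1) • U ν 4 else if b = 5 then (δs ν 5 - δs ν 0) • U ν 5 else U ν b) / μ ν) atTop (𝓝 (Γ a b)))
    (hΓ' : ∀ a b, Tendsto (fun ν => polar
      (if a = 0 then Real.exp (δs ν 0 * L ν) • U ν 0 + Real.exp (δs ν 5 * L ν) • U ν 5
        else if a = 1 then Real.exp (δs ν 1 * L ν) • U ν 1 + Real.exp (δs ν 4 * L ν) • U ν 4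
        else if a = 4 then (δs ν 4 - δs ν 1) • (Real.exp (δs ν 4 * L ν) • U ν 4)
        else if a = 5 then (δs ν 5 - δs ν 0) • (Real.exp (δs ν 5 * L ν) • U ν 5) else Real.exp (δs ν a * L ν) • U ν a)
      (if b = 0 then Real.exp (δs ν 0 * L ν) • U ν 0 + Real.exp (δs ν 5 * L ν) • U ν 5
        else if b = 1 then Real.exp (δs ν 1 * L ν) • U ν 1 + Real.exp (δs ν 4 * L ν) • U ν 4
        else if b = 4 then (δs ν 4 - δs ν 1) • (Real.exp (δs ν 4 * L ν) • U ν 4)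
        else if b = 5 then (δs ν 5 - δs ν 0) • (Real.exp (δs ν 5 * L ν) • U ν 5) else Real.exp (δs ν b * L ν) • U ν b) / μ' ν)
      atTop (𝓝 (Γ' a b)))
    (p q p' q' : Fin 6) (hpq : Γ p q ≠ 0) (hp'q' : Γ' p' q' ≠ 0) :
    δ0 p + δ0 q ≤ δ0 p' + δ0 q' := by
  by_contra hlt
  push Not at hlt
  set dd : ℝ := (δ0 p + δ0 q) - (δ0 p' + δ0 q') with hdd
  have hdpos : 0 < dd := by rw [hdd]; linarith
  set w : ℕ → ℝ := fun ν => δs ν 5 - δs ν 0 with hw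
  set w' : ℕ → ℝ := fun ν => δs ν 4 - δs ν 1 with hw'
  set κ : ℝ := |Γ p q| / 2 with hκ
  set κ' : ℝ := |Γ' p' q'| / 2 with hκ'
  have hκpos : 0 < κ := by rw [hκ]; exact half_pos (abs_pos.mpr hpq)
  have hκ'pos : 0 < κ' := by rw [hκ']; exact half_pos (abs_pos.mpr hp'q')
  -- eventual lower bounds on the alive entries
  have e1 : ∀ᶠ ν in atTop, κ * μ ν ≤ |polar (if p = 0 then U ν 0 + U ν 5 else if p = 1 then U ν 1 + U ν 4
        else if p = 4 then (δs ν 4 - δs ν 1) • U ν 4 else if p = 5 then (δs ν 5 - δs ν 0) • U ν 5 else U ν p)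
      (if q = 0 then U ν 0 + U ν 5 else if q = 1 then U ν 1 + U ν 4
        else if q = 4 then (δs ν 4 - δs ν 1) • U ν 4 else if q = 5 then (δs ν 5 - δs ν 0) • U ν 5 else U ν q)| := by
    have h := ((hΓ p q).abs).eventually_const_lt (show κ < |Γ p q| by rw [hκ]; linarith [abs_pos.mpr hpq])
    filter_upwards [h] with ν hν
    rw [abs_div, abs_of_pos (hμ ν), lt_div_iff₀ (hμ ν)] at hν
    exact hν.le
  have e2 : ∀ᶠ ν in atTop, κ' * μ' ν ≤ |polar
      (if p' = 0 then Real.exp (δs ν 0 * L ν) • U ν 0 + Real.exp (δs ν 5 * L ν) • U ν 5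
        else if p' = 1 then Real.exp (δs ν 1 * L ν) • U ν 1 + Real.exp (δs ν 4 * L ν) • U ν 4
        else if p' = 4 then (δs ν 4 - δs ν 1) • (Real.exp (δs ν 4 * L ν) • U ν 4)
        else if p' = 5 then (δs ν 5 - δs ν 0) • (Real.exp (δs ν 5 * L ν) • U ν 5) else Real.exp (δs ν p' * L ν) • U ν p')
      (if q' = 0 then Real.exp (δs ν 0 * L ν) • U ν 0 + Real.exp (δs ν 5 * L ν) • U ν 5
        else if q' = 1 then Real.exp (δs ν 1 * L ν) • U ν 1 + Real.exp (δs ν 4 * L ν) • U ν 4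
        else if q' = 4 then (δs ν 4 - δs ν 1) • (Real.exp (δs ν 4 * L ν) • U ν 4)
        else if q' = 5 then (δs ν 5 - δs ν 0) • (Real.exp (δs ν 5 * L ν) • U ν 5) else Real.exp (δs ν q' * L ν) • U ν q')| := by
    have h := ((hΓ' p' q').abs).eventually_const_lt (show κ' < |Γ' p' q'| by rw [hκ']; linarith [abs_pos.mpr hp'q'])
    filter_upwards [h] with ν hν
    rw [abs_div, abs_of_pos (hμ' ν), lt_div_iff₀ (hμ' ν)] at hν
    exact hν.le
  -- the stage exponent gap and the two Weyl gaps
  have e3 : ∀ᶠ ν in atTop, (δs ν p' + δs ν q') - (δs ν p + δs ν q) ≤ -(dd / 2) := by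
    have hlim : Tendsto (fun ν => (δs ν p' + δs ν q') - (δs ν p + δs ν q)) atTop (𝓝 ((δ0 p' + δ0 q') - (δ0 p + δ0 q))) :=
      ((hδ p').add (hδ q')).sub ((hδ p).add (hδ q))
    exact (hlim.eventually (Iic_mem_nhds (by rw [hdd]; linarith))).mono fun ν hν => hν
  have e4 : ∀ᶠ ν in atTop, |w ν| ≤ dd / 32 := by
    have hw0 : Tendsto (fun ν => |w ν|) atTop (𝓝 |(0 : ℝ)|) := by
      have := (hδ 5).sub (hδ 0)
      rw [h50, sub_self] at this
      exact this.abs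
    rw [abs_zero] at hw0
    exact (hw0.eventually (Iic_mem_nhds (by positivity))).mono fun ν hν => hν
  have e4' : ∀ᶠ ν in atTop, |w' ν| ≤ dd / 32 := by
    have hw0 : Tendsto (fun ν => |w' ν|) atTop (𝓝 |(0 : ℝ)|) := by
      have := (hδ 4).sub (hδ 1)
      rw [h41, sub_self] at this
      exact this.abs
    rw [abs_zero] at hw0
    exact (hw0.eventually (Iic_mem_nhds (by positivity))).mono fun ν hν => hν
  have e5 : ∀ᶠ ν in atTop, 0 ≤ L ν := hL.eventually_ge_atTop 0
  have e6 := transvection_decay dd (κ * κ') hdpos (mul_pos hκpos hκ'pos) L hL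
  have e7 : ∀ᶠ ν in atTop, 2 ≤ Real.exp (dd / 32 * L ν) :=
    (Real.tendsto_exp_atTop.comp (hL.const_mul_atTop (by positivity : (0 : ℝ) < dd / 32))).eventually_ge_atTop 2
  -- contradiction at a late stage
  have hfalse : ∀ᶠ ν : ℕ in atTop, False := by
    filter_upwards [e1, e2, e3, e4, e4', e5, e6, e7] with ν h1 h2 h3 h4 h4' h5 h6 h7
    -- forward transfer bound at the second scale
    have hfwd := polar_frameShift_le₂ (δs ν) (U ν) (L ν) (μ ν) (hdom ν) p' q'
    -- backward transfer bound: shift the shifted letters by `−L`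
    have hbwd := polar_frameShift_le₂ (δs ν) (fun l => Real.exp (δs ν l * L ν) • U ν l) (-(L ν)) (μ' ν) (hdom' ν) p q
    simp only [shift_neg_shift] at hbwd
    -- the four transvection coefficients are `≤ L e^{dd L/32}`, and `1 + 2 L e^{dd L/32} ≤ 1 + L e^{dd L/16}` late
    have hE : Real.exp (|w ν| * L ν) ≤ Real.exp (dd / 32 * L ν) := Real.exp_le_exp.mpr (mul_le_mul_of_nonneg_right h4 h5)
    have hE' : Real.exp (|w' ν| * L ν) ≤ Real.exp (dd / 32 * L ν) := Real.exp_le_exp.mpr (mul_le_mul_of_nonneg_right h4' h5)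
    have hsq : Real.exp (dd / 32 * L ν) * Real.exp (dd / 32 * L ν) = Real.exp (dd / 16 * L ν) := by
      rw [← Real.exp_add]; congr 1; ring
    have htwo : 2 * (L ν * Real.exp (dd / 32 * L ν)) ≤ L ν * Real.exp (dd / 16 * L ν) := by
      rw [← hsq]
      have hx : 0 ≤ L ν * Real.exp (dd / 32 * L ν) * (Real.exp (dd / 32 * L ν) - 2) :=
        mul_nonneg (mul_nonneg h5 (Real.exp_pos _).le) (by linarith)
      nlinarith [hx]
    have hb1 : |dslope (fun y : ℝ => Real.exp (y * L ν)) 0 (δs ν 5 - δs ν 0)| ≤ L ν * Real.exp (dd / 32 * L ν) := by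
      have hb := abs_dslope_exp_le (L ν) (δs ν 5 - δs ν 0)
      rw [abs_of_nonneg h5] at hb
      exact le_trans hb (mul_le_mul_of_nonneg_left hE h5)
    have hb2 : |dslope (fun y : ℝ => Real.exp (y * L ν)) 0 (δs ν 4 - δs ν 1)| ≤ L ν * Real.exp (dd / 32 * L ν) := by
      have hb := abs_dslope_exp_le (L ν) (δs ν 4 - δs ν 1)
      rw [abs_of_nonneg h5] at hb
      exact le_trans hb (mul_le_mul_of_nonneg_left hE' h5)
    have hb3 : |dslope (fun y : ℝ => Real.exp (y * -L ν)) 0 (δs ν 5 - δs ν 0)| ≤ L ν * Real.exp (dd / 32 * L ν) := by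
      have hb := abs_dslope_exp_le (-(L ν)) (δs ν 5 - δs ν 0)
      rw [abs_neg, abs_of_nonneg h5] at hb
      exact le_trans hb (mul_le_mul_of_nonneg_left hE h5)
    have hb4 : |dslope (fun y : ℝ => Real.exp (y * -L ν)) 0 (δs ν 4 - δs ν 1)| ≤ L ν * Real.exp (dd / 32 * L ν) := by
      have hb := abs_dslope_exp_le (-(L ν)) (δs ν 4 - δs ν 1)
      rw [abs_neg, abs_of_nonneg h5] at hb
      exact le_trans hb (mul_le_mul_of_nonneg_left hE' h5)
    have hΛ₁c : 1 + |dslope (fun y : ℝ => Real.exp (y * L ν)) 0 (δs ν 5 - δs ν 0)| + |dslope (fun y : ℝ => Real.exp (y * L ν)) 0 (δs ν 4 - δs ν 1)|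
        ≤ 1 + L ν * Real.exp (dd / 16 * L ν) := by linarith
    have hΛ₂c : 1 + |dslope (fun y : ℝ => Real.exp (y * -L ν)) 0 (δs ν 5 - δs ν 0)| + |dslope (fun y : ℝ => Real.exp (y * -L ν)) 0 (δs ν 4 - δs ν 1)|
        ≤ 1 + L ν * Real.exp (dd / 16 * L ν) := by linarith
    have hΛ4 : (1 + |dslope (fun y : ℝ => Real.exp (y * -L ν)) 0 (δs ν 5 - δs ν 0)| + |dslope (fun y : ℝ => Real.exp (y * -L ν)) 0 (δs ν 4 - δs ν 1)|) ^ 2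
        * (1 + |dslope (fun y : ℝ => Real.exp (y * L ν)) 0 (δs ν 5 - δs ν 0)| + |dslope (fun y : ℝ => Real.exp (y * L ν)) 0 (δs ν 4 - δs ν 1)|) ^ 2
        ≤ (1 + L ν * Real.exp (dd / 16 * L ν)) ^ 4 := by
      have h1' := pow_le_pow_left₀ (by positivity) hΛ₁c 2
      have h2' := pow_le_pow_left₀ (by positivity) hΛ₂c 2
      calc _ ≤ (1 + L ν * Real.exp (dd / 16 * L ν)) ^ 2 * (1 + L ν * Real.exp (dd / 16 * L ν)) ^ 2 :=
            mul_le_mul h2' h1' (by positivity) (by positivity)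
        _ = (1 + L ν * Real.exp (dd / 16 * L ν)) ^ 4 := by ring
    have hexp : Real.exp ((δs ν p + δs ν q) * -L ν) * Real.exp ((δs ν p' + δs ν q') * L ν) ≤ Real.exp (-(dd / 2 * L ν)) := by
      rw [← Real.exp_add]
      apply Real.exp_le_exp.mpr
      have hh := mul_le_mul_of_nonneg_right h3 h5
      have : (δs ν p + δs ν q) * -L ν + (δs ν p' + δs ν q') * L ν = ((δs ν p' + δs ν q') - (δs ν p + δs ν q)) * L ν := by ring
      rw [this]
      linarith
    -- combine
    have hfin : κ * κ' ≤ (1 + L ν * Real.exp (dd / 16 * L ν)) ^ 4 * Real.exp (-(dd / 2 * L ν)) :=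
      scale_combine (hμ ν) (hμ' ν) hκ'pos.le (Real.exp_pos _).le (Real.exp_pos _).le (by positivity) (by positivity)
        (Real.exp_pos _).le (le_trans h1 hbwd) (le_trans h2 hfwd) hexp hΛ4
    exact absurd (lt_of_le_of_lt hfin h6) (lt_irrefl _)
  exact hfalse.exists.elim fun _ h => h

end Summit.ValiantsHypothesis.ValiantsHypothesis.Theorems.LacunarySymmetroidMatrixDescartes.WallBubbling
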